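import Summits.AtomisticToContinuum.HydrodynamicLimit.Theorems.ImplosionDichotomyHydroLimitProfilewiseBandKcwfQReduction
import Summits.AtomisticToContinuum.HydrodynamicLimit.Theorems.ImplosionDichotomyHydroLimitInBandSignedInputs
import HarnessLib

/-!
# DOCK-Q — the binder `ClampedTransferDockOfInputsQ` (stmt-AtomisticToContinuum-18054) holds

`Theses.OneFlightGossipEngine.ClampedTransferDockOfInputsQ :=
  SuperExponentialEnergyTails → KineticCurrentsLDAlongFamiliesQ → LocalClampedTransferLDAlongFamilies → EnergyActivityTails →
  KineticCurrentsLDAlongFamilies → CollisionActivityTails → HydrodynamicLimit`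
is modus ponens over LANDED theorems: the five-input signed composition of the heart
(`Theorems.HydroLimitInBandSignedBand.hydrodynamicLimit_of_signedInputs`, p148646 — KCWF from KCWF-Q, ECT from SEET, the
D-shape one-window ledger over the signed cubic channel, window continuity, the guarded Grönwall core, reduction and dock) read
through the identity `Theorems.HydroLimitProfilewiseBandKcwfQ.kcwfQ_iff_routeItem` (p152422: the route item stmt-18052 and the
heart's Theorems-side definition of KCWF-Q are one proposition). The antecedent `KineticCurrentsLDAlongFamilies` (stmt-16659) is
not needed (it follows from KCWF-Q by the landed `kcwf_of_kcwfQ` anyway).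

Lead `prover-line-stmt-AtomisticToContinuum-17372-c9-0` (crux HydroLimitProfilewiseBand, whose line shares these inputs; the
candidate was attached on stmt-18054 by lead c8).
-/

noncomputable section

namespace Summit.AtomisticToContinuum.HydrodynamicLimit.Theorems.ClampedTransferDockQ

open Summit.AtomisticToContinuum.HydrodynamicLimit.Theses
open Summit.AtomisticToContinuum.HydrodynamicLimit.Theorems.HydroLimitInBandSignedBand (hydrodynamicLimit_of_signedInputs)
open Summit.AtomisticToContinuum.HydrodynamicLimit.Theorems.HydroLimitProfilewiseBandKcwfQ (kcwfQ_iff_routeItem)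

/-- **DOCK-Q (stmt-AtomisticToContinuum-18054) holds**: the packing-guarded hydrodynamic limit from SEET (stmt-17701), KCWF-Q
(stmt-18052), LCTF (stmt-17691), EAT (stmt-17703) and CAT (stmt-13734) — the landed signed five-input composition of the heart
(p148646) transported along `kcwfQ_iff_routeItem`; the sixth antecedent KCWF (stmt-16659) is idle. [cite: Yau1991, §2] -/
theorem clampedTransferDockOfInputsQ_proof : OneFlightGossipEngine.ClampedTransferDockOfInputsQ :=
  fun hS hQ h₃ h₄ _hK h₇ => hydrodynamicLimit_of_signedInputs hS (kcwfQ_iff_routeItem.1 hQ) h₃ h₄ h₇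

end Summit.AtomisticToContinuum.HydrodynamicLimit.Theorems.ClampedTransferDockQ

end
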